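import Summits.ResolutionOfSingularities.ResolutionOfSingularities.Theorems.FrobeniusLadderFInjectiveMacaulayficationDiagonalBPCIPointFloorLegal
import Summits.ResolutionOfSingularities.ResolutionOfSingularities.Theorems.FrobeniusLadderFInjectiveMacaulayficationDiagonalBPCIChart5NotFull
import Summits.ResolutionOfSingularities.ResolutionOfSingularities.Theorems.FrobeniusLadderFInjectiveMacaulayficationDiagonalBPCIRow
import Summits.ResolutionOfSingularities.ResolutionOfSingularities.Theorems.FrobeniusLadderFInjectiveMacaulayficationDiagonalBPCIVertexNotFull
import Mathlib.FieldTheory.IsAlgClosed.AlgebraicClosure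
import HarnessLib

/-!
# ★★★ ROW #11 = BED CI-1, TWO-SIDED: the diagonal Brieskorn–Pham complete-intersection pair `X = V(x₀²+x₁³+x₂³+x₃⁴+x₄⁵+x₅⁵, x₀²+2x₁³+3x₂³+4x₃⁴+5x₄⁵+6x₅⁵) ⊂ 𝔸⁶`
# (codimension 2, dimension 4, isolated, `char k = p ≥ 7`, `k` ANY field) at the POINT FLOOR: LEGAL ∧ NOT FULL ∧ CURED — the first two-sided census row of the F-half on a
# NON-HYPERSURFACE germ, in the registrar's letter shape
# (crux `FInjectiveMacaulayfication` stmt-ResolutionOfSingularities-15315, chain w45a; res-L1-w45a-plan-1 RULINGS R23.10/R23.11 (3) «registrar-style two-sided row `row11_CI1_pointFloor`»;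
# seat res-L1-w45a-stub-2 g13)

[OURS · L1 W4.5a] Support file (`--supports stmt-ResolutionOfSingularities-15315 --as helper`); def-free; UNCONDITIONAL; no named fact, no sorry; NOT a statement of any
manuscript; replaces the role of NO printed item. Nothing of the crux is proved: a census row is a certificate on ONE bed. AI-written (AI review weaker than expert review).

LETTER SHAPE «ROW» (as in ✓ `FCensusRegistrar`): for every blowing up `g : S′ → Spec 𝒪_{X,v}` along the point floor `𝔪̃|`: (LEGAL: centre `≠ ⊥`, supported in the non-regular locus,
`S′` regular off the closed fibre, CM everywhere — ✓ `DiagonalBPCIPointFloorLegal`) ∧ (NOT FULL: some stalk over the closed point is not `FullCl p` — ✓ `DiagonalBPCIChart5NotFull`) ∧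
(CURED: `∃ 𝓚 ≠ ⊥` on `S′` supported over the closed point, every blowing up of `S′` along `𝓚` FULL everywhere — ✓ `DiagonalBPCIRow`, the CI class theorem with geometric
non-degeneracy read in `AlgebraicClosure k`).
* ★★★ `row11_CI1_pointFloor (p) (hp : 7 ≤ p) (k) [CharP k p]` — the ROW, `k` any field of characteristic `p ≥ 7`.
* ★ `row_nonHypersurface_diagonalBPCI` — the INPUT/GERM half next to the cure: `¬ FullCl p (𝒪_{X,v})` (✓ `DiagonalBPCIVertexNotFull`, every `p`) ∧ (point floor CURED, `p ≥ 7`) —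
  R23.10's registrar pairing.
[cite: Fedder1983, Thm. 1.12 and Prop. 2.1] [cite: IshiiSingularities2018, Thm. 4.4.23] [cite: CuetoPopescupampuStepanov2023, Def. 4.2] [cite: GortzWedhorn2020, Prop. 13.91 (2)]
[cite: StacksProject, Tag 0804 and Tag 080A]
-/

-- single-problem summit: the doubled namespace component is forced
set_option linter.dupNamespace false

noncomputable section

open AlgebraicGeometry CategoryTheory Literature.AlgebraicGeometry.Resolution TopologicalSpace IsLocalRing MvPolynomial

namespace Summit.ResolutionOfSingularities.ResolutionOfSingularities.Theorems.FInjectiveMacaulayfication.DiagonalBPCIRowTwoSided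

open Summit.ResolutionOfSingularities.ResolutionOfSingularities.Theorems.FInjectiveMacaulayfication SliceableCentre

/-- ★★★ **ROW #11 = BED CI-1, TWO-SIDED, `p ≥ 7`, ANY FIELD: LEGAL ∧ NOT FULL ∧ CURED at the point floor of the diagonal Brieskorn–Pham CI pair in `𝔸⁶`** (codimension 2,
dimension 4, isolated singular vertex). The three conjuncts are ✓ `DiagonalBPCIPointFloorLegal.diagonalBPCI_pointFloor_input_legal` (the four monic-tower Rees charts cover `Bl_𝔪X`
and are CM), ✓ `DiagonalBPCIChart5NotFull.diagonalBPCI_pointFloor_not_full` (CI Fedder necessity at the origin of the `x₅`-chart, p-uniform), ✓ `DiagonalBPCIRow.diagonalBPCI_pointFloorCured`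
(the unconditional CI class theorem, geometric Khovanskii non-degeneracy read in `AlgebraicClosure k`). [OURS · assembly of landed theorems] -/
theorem row11_CI1_pointFloor (p : ℕ) [Fact p.Prime] (hp : 7 ≤ p) (k : Type) [Field k] [CharP k p]
    (F : Fin 2 → MvPolynomial (Fin 6) k)
    (hF0 : F 0 = X 0 ^ 2 + X 1 ^ 3 + X 2 ^ 3 + X 3 ^ 4 + X 4 ^ 5 + X 5 ^ 5)
    (hF1 : F 1 = X 0 ^ 2 + C 2 * X 1 ^ 3 + C 3 * X 2 ^ 3 + C 4 * X 3 ^ 4 + C 5 * X 4 ^ 5 + C 6 * X 5 ^ 5)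
    (v : Spec (.of (MvPolynomial (Fin 6) k ⧸ Ideal.span (Set.range F))))
    (hvm : v.asIdeal = Ideal.span (Set.range fun j : Fin 6 => Ideal.Quotient.mk (Ideal.span (Set.range F)) (X j)))
    (S' : Scheme.{0}) (g' : S' ⟶ Spec ((Spec (.of (MvPolynomial (Fin 6) k ⧸ Ideal.span (Set.range F)))).presheaf.stalk v))
    (hg' : IsBlowup g' ((affineBlowup.idealSheaf (Ideal.span (Set.range fun j : Fin 6 => Ideal.Quotient.mk (Ideal.span (Set.range F)) (X j)))).comap
      ((Spec (.of (MvPolynomial (Fin 6) k ⧸ Ideal.span (Set.range F)))).fromSpecStalk v))) :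
    (((affineBlowup.idealSheaf (Ideal.span (Set.range fun j : Fin 6 => Ideal.Quotient.mk (Ideal.span (Set.range F)) (X j)))).comap
        ((Spec (.of (MvPolynomial (Fin 6) k ⧸ Ideal.span (Set.range F)))).fromSpecStalk v)) ≠ ⊥ ∧
      (((((affineBlowup.idealSheaf (Ideal.span (Set.range fun j : Fin 6 => Ideal.Quotient.mk (Ideal.span (Set.range F)) (X j)))).comap
        ((Spec (.of (MvPolynomial (Fin 6) k ⧸ Ideal.span (Set.range F)))).fromSpecStalk v))).support :
          Set (Spec ((Spec (.of (MvPolynomial (Fin 6) k ⧸ Ideal.span (Set.range F)))).presheaf.stalk v))) ⊆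
        (Scheme.regularLocus (Spec ((Spec (.of (MvPolynomial (Fin 6) k ⧸ Ideal.span (Set.range F)))).presheaf.stalk v)))ᶜ) ∧
      (∀ s : S', g'.base s ≠ closedPoint ((Spec (.of (MvPolynomial (Fin 6) k ⧸ Ideal.span (Set.range F)))).presheaf.stalk v) → s ∈ Scheme.regularLocus S') ∧
      (∀ s : S', CMCl (S'.presheaf.stalk s))) ∧
    (∃ s : S', g'.base s = closedPoint ((Spec (.of (MvPolynomial (Fin 6) k ⧸ Ideal.span (Set.range F)))).presheaf.stalk v) ∧ ¬ FullCl p (S'.presheaf.stalk s)) ∧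
    (∃ 𝓚 : S'.IdealSheafData, 𝓚 ≠ ⊥ ∧
      (∀ s ∈ (𝓚.support : Set S'), g'.base s = closedPoint ((Spec (.of (MvPolynomial (Fin 6) k ⧸ Ideal.span (Set.range F)))).presheaf.stalk v)) ∧
      ∀ (S'' : Scheme.{0}) (π : S'' ⟶ S'), IsBlowup π 𝓚 → ∀ s : S'', FullCl p (S''.presheaf.stalk s)) := by
  have h3 : (3 : k) ≠ 0 := by exact_mod_cast DiagonalBPCIRow.natCast_ne_zero_of_lt (R := k) p 3 (by norm_num) (by omega)
  exact ⟨DiagonalBPCIPointFloorLegal.diagonalBPCI_pointFloor_input_legal p hp k F hF0 hF1 v hvm S' g' hg',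
    DiagonalBPCIChart5NotFull.diagonalBPCI_pointFloor_not_full p k h3 F hF0 hF1 v hvm S' g' hg',
    DiagonalBPCIRow.diagonalBPCI_pointFloorCured p hp k (AlgebraicClosure k) F hF0 hF1 v hvm S' g' hg'⟩

/-- ★ **THE INPUT/GERM HALF NEXT TO THE CURE** (R23.10's pairing): the vertex of BED CI-1 is NOT a FULL point (every prime `p`, every field — ✓ `DiagonalBPCIVertexNotFull`) AND, for
`p ≥ 7`, the point floor is CURED (✓ `DiagonalBPCIRow`). [OURS · assembly of landed theorems] -/
theorem row_nonHypersurface_diagonalBPCI (p : ℕ) [Fact p.Prime] (hp : 7 ≤ p) (k : Type) [Field k] [CharP k p]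
    (F : Fin 2 → MvPolynomial (Fin 6) k)
    (hF0 : F 0 = X 0 ^ 2 + X 1 ^ 3 + X 2 ^ 3 + X 3 ^ 4 + X 4 ^ 5 + X 5 ^ 5)
    (hF1 : F 1 = X 0 ^ 2 + C 2 * X 1 ^ 3 + C 3 * X 2 ^ 3 + C 4 * X 3 ^ 4 + C 5 * X 4 ^ 5 + C 6 * X 5 ^ 5)
    (v : Spec (.of (MvPolynomial (Fin 6) k ⧸ Ideal.span (Set.range F))))
    (hvm : v.asIdeal = Ideal.span (Set.range fun j : Fin 6 => Ideal.Quotient.mk (Ideal.span (Set.range F)) (X j))) :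
    ¬ FullCl p ((Spec (.of (MvPolynomial (Fin 6) k ⧸ Ideal.span (Set.range F)))).presheaf.stalk v) ∧
    ∀ (S' : Scheme.{0}) (g' : S' ⟶ Spec ((Spec (.of (MvPolynomial (Fin 6) k ⧸ Ideal.span (Set.range F)))).presheaf.stalk v)),
      IsBlowup g' ((affineBlowup.idealSheaf (Ideal.span (Set.range fun j : Fin 6 => Ideal.Quotient.mk (Ideal.span (Set.range F)) (X j)))).comap
        ((Spec (.of (MvPolynomial (Fin 6) k ⧸ Ideal.span (Set.range F)))).fromSpecStalk v)) →
      ∃ 𝓚 : S'.IdealSheafData, 𝓚 ≠ ⊥ ∧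
        (∀ s ∈ (𝓚.support : Set S'), g'.base s = closedPoint ((Spec (.of (MvPolynomial (Fin 6) k ⧸ Ideal.span (Set.range F)))).presheaf.stalk v)) ∧
        ∀ (S'' : Scheme.{0}) (π : S'' ⟶ S'), IsBlowup π 𝓚 → ∀ s : S'', FullCl p (S''.presheaf.stalk s) :=
  ⟨DiagonalBPCIVertexNotFull.diagonalBPCI_vertex_not_full p k F hF0 hF1 v hvm,
    DiagonalBPCIRow.diagonalBPCI_pointFloorCured p hp k (AlgebraicClosure k) F hF0 hF1 v hvm⟩

end Summit.ResolutionOfSingularities.ResolutionOfSingularities.Theorems.FInjectiveMacaulayfication.DiagonalBPCIRowTwoSided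

end
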